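import Literature.MathematicalPhysics.QuantumFieldTheory.Sweep1
import Literature.MathematicalPhysics.QuantumLattice.GaugeGroups
import HarnessLib

/-!
# `u1Rep` is a unitary model: `U(1) ≅ U(1) ⊂ M₁(ℂ)` through its defining representation

The Wilson lattice gauge theory files of this library state their weak-coupling theorems for a
*unitary model* `ρ : G →* M_N(ℂ)` (`IsUnitaryModel ρ`, `Sweep1.lean`: `ρ` continuous and injective with
image exactly the unitary group `U(N)`), i.e. for "`G = U(N)` in the defining representation"
(Osterwalder–Seiler 1978 §5; Chatterjee, J. Funct. Anal. 271 (2016), arXiv:1602.01222, §2).  This file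
records the case `N = 1`: the defining representation `u1Rep : Circle →* M₁(ℂ)` of `U(1)`
(`GaugeGroups.lean`: `u1Rep z = z · 1`, continuous `continuous_u1Rep`, faithful `u1Rep_injective`,
unitary-valued `u1Rep_mem_unitaryGroup`) is a unitary model — the only missing point being that EVERY
unitary `1 × 1` complex matrix is `u1Rep z` for the unit complex number `z` given by its entry.
Consumers: the `U(1)₄` one-point theorems at weak coupling (mean plaquette, plaquette second moment)
obtained from `SoloBlind.weakCoupling_singlePlaquette`.
-/

noncomputable section

namespace Literature.MathematicalPhysics.QuantumFieldTheory

open Literature.MathematicalPhysics.QuantumLattice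

/-- **`u1Rep : U(1) → M₁(ℂ)` is a unitary model** (`G ≅ U(1)` through `ρ`, the case `N = 1` of
"`G = U(N)` in its defining representation"): continuous, faithful, with image exactly the unitary
`1 × 1` matrices (a unitary `1 × 1` matrix `M` has `|M₀₀| = 1`, and `M = u1Rep ⟨M₀₀⟩`) — the case
`N = 1` of the setting "`U(N)` lattice gauge theory in the defining representation" of Chatterjee's
free-energy theorem, in the tree's predicate `IsUnitaryModel`.
[cite: arXiv160201222, §2 (the model: G = U(N) acting by its defining representation; here N = 1)] -/
theorem isUnitaryModel_u1Rep : IsUnitaryModel u1Rep := by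
  refine ⟨continuous_u1Rep, u1Rep_injective, ?_⟩
  ext M
  constructor
  · rintro ⟨z, rfl⟩
    exact u1Rep_mem_unitaryGroup z
  · intro hM
    have hmul : M * star M = 1 := Matrix.mem_unitaryGroup_iff.1 hM
    have h00 : M 0 0 * (starRingEnd ℂ) (M 0 0) = 1 := by
      have h := congrFun (congrFun hmul 0) 0
      simpa [Matrix.mul_apply, Matrix.star_apply] using h
    have hnorm : ‖M 0 0‖ = 1 := by
      have h1 : Complex.normSq (M 0 0) = 1 := by
        have h2 : ((Complex.normSq (M 0 0) : ℝ) : ℂ) = 1 := by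
          rw [Complex.normSq_eq_conj_mul_self, mul_comm]; exact h00
        exact_mod_cast h2
      have h3 : ‖M 0 0‖ ^ 2 = 1 := by rw [← Complex.normSq_eq_norm_sq]; exact h1
      nlinarith [h3, norm_nonneg (M 0 0)]
    refine ⟨⟨M 0 0, by simp [Submonoid.unitSphere, hnorm]⟩, ?_⟩
    ext i j
    fin_cases i; fin_cases j
    simp [u1Rep_apply, Matrix.scalar_apply]

end Literature.MathematicalPhysics.QuantumFieldTheory
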